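import Mathlib
import HarnessLib
import Summits.NavierStokesRegularity.NavierStokesRegularity.Theorems.UnthreadedRigidityDoorUnthreadedRigidityVirialHornShellCalculus
import Summits.NavierStokesRegularity.NavierStokesRegularity.Theorems.UnthreadedRigidityDoorUnthreadedRigidityVirialHornWindowRegularity

/-!
# Route `UnthreadedRigidityDoor`, item `UnthreadedRigidity` (W2, stmt-NavierStokesRegularity-27585) — LINE g11-1 «VIRIAL HORN»:
# W₂ — the ANALYTIC-PROFILE conjunct of BRIDGE W `WindowWedgeAnalyticL`, PROVED

`theorem windowWedge_analytic_profiles`: under the hypotheses of the bridge W `WindowWedgeAnalyticL` VERBATIM (degree `l ≥ 1`, open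
time set `S`, a jointly continuous, locally bounded, unthreaded Oseen-mild window `u` whose slices are admissible `l`-isotypic data
`u t = isoShellL n (cf t) B x₀` over a linearly independent family `B` of solid harmonics), every radial coefficient profile `cf t m`,
`t ∈ S`, is REAL-ANALYTIC on `(0, ∞)` — the second conjunct of W's conclusion.  After this the bridge W reduces to its WEDGE LAW
(`… → ∀ t ∈ S, WedgeVanishesL n (cf t)`, the order-one law + injectivity of `{·,·}` on `Λ²V_l`), which is NOT touched here; the glue
`windowWedgeAnalyticL_of_wedgeLaw : (wedge law under W's hypotheses) → WindowWedgeAnalyticL` records that W is now LITERALLY its wedge law.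

Proof: the slice `u t` is real-analytic on `ℝ³` (`window_analyticOnNhd_slice`, p702598: KNSS/Lemarié-Rieusset interior
analyticity + forward uniqueness); its stream function `ψ(y) = Σ_m c_m(|y|) B_m(y)` equals `⟪u t (x₀ + y), y⟫ / (l(l+1))`
(`inner_isoShellL_self`, `…ShellCalculus`), hence is analytic; the family `B` stays linearly independent on the unit sphere
(`linearIndependent_sphere`, homogeneity), so there are unit points `p_1,…,p_n` with invertible evaluation matrix `M_{ij} = B_j(p_i)`
(`exists_points_isUnit`: the rows `(B_j(x))_j` span `ℝⁿ`, else a non-zero functional yields a relation), and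
`c_m(r) = Σ_i (M⁻¹)_{mi} r^{−l} ψ(r p_i)` for `r > 0` is analytic.

HONEST LABEL: half of one M–L bridge of a RUNG line about SPECIAL isotypic windows; `UnthreadedRigidity` (27585), W2 and NS
regularity remain OPEN; no summit statement is proved.  `--supports stmt-NavierStokesRegularity-27585` (helper); ns-crc-p2 g8
(director-ns dss_144 (2) GO).  [cite: LemarieRieusset2016, Thm. 9.12 (PDF p. 260); KochNadirashviliSereginSverak2009, §4]
-/

-- the summit and its single sub-problem share the name (CONVENTIONS §1)
set_option linter.dupNamespace false

namespace Summit.NavierStokesRegularity.NavierStokesRegularity.Theorems.UnthreadedRigidity.VirialHorn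

open scoped Topology
open Filter Set Function
open Summit.NavierStokesRegularity.NavierStokesRegularity.Theorems.UnthreadedRigidity.ProfileHorn (E3)
open Literature.Analysis.FluidPDE

/-! ## §5 Linear algebra: evaluation points for a linearly independent family of functions -/

/-- A linearly independent family of `n` real functions has `n` evaluation points with invertible evaluation matrix
`(g_j(p_i))_{ij}` (the row vectors `(g_j(x))_j`, `x ∈ X`, span `ℝⁿ`, else a non-zero functional kills them all, i.e. a
non-trivial relation `Σ a_j g_j = 0`). [folklore] -/
theorem exists_points_isUnit {X : Type*} {n : ℕ} (g : Fin n → X → ℝ) (hg : LinearIndependent ℝ g) :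
    ∃ p : Fin n → X, IsUnit (Matrix.of fun i j => g j (p i)) := by
  classical
  -- the rows `r x = (g_j(x))_j` span `ℝⁿ`
  set r : X → (Fin n → ℝ) := fun x j => g j x with hr
  have hspan : Submodule.span ℝ (Set.range r) = ⊤ := by
    by_contra hne
    obtain ⟨f, hf0, hker⟩ := Submodule.exists_le_ker_of_lt_top _ (lt_top_iff_ne_top.2 hne)
    apply hf0
    -- the coefficients of `f` give a relation among the `g_j`
    have hrel : ∀ x, ∑ j, (f fun k => if j = k then 1 else 0) * g j x = 0 := by
      intro x
      have hx : f (r x) = 0 := by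
        have : r x ∈ Submodule.span ℝ (Set.range r) := Submodule.subset_span ⟨x, rfl⟩
        exact LinearMap.mem_ker.1 (hker this)
      rw [LinearMap.pi_apply_eq_sum_univ f (r x)] at hx
      simpa [hr, mul_comm] using hx
    have hzero : ∀ j, (f fun k => if j = k then 1 else 0) = 0 := by
      have hli := Fintype.linearIndependent_iff.1 hg (fun j => f fun k => if j = k then 1 else 0) ?_
      · exact hli
      · funext x
        simpa [Finset.sum_apply, Pi.smul_apply, smul_eq_mul] using hrel x
    apply LinearMap.ext
    intro v
    rw [LinearMap.pi_apply_eq_sum_univ f v]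
    simp only [hzero, smul_eq_mul, mul_zero, Finset.sum_const_zero, LinearMap.zero_apply]
  -- extract `n` independent rows
  obtain ⟨t, ht, hts, hti⟩ := exists_linearIndependent ℝ (Set.range r)
  rw [hspan] at hts
  have htfin : t.Finite := hti.setFinite
  haveI : Fintype t := htfin.fintype
  have hcard : Fintype.card t = n := by
    have h1 : Module.finrank ℝ (Submodule.span ℝ t) = t.toFinset.card :=
      finrank_span_set_eq_card (R := ℝ) (M := Fin n → ℝ) hti
    rw [hts, finrank_top, Module.finrank_fin_fun] at h1
    rw [← Set.toFinset_card]
    exact h1.symm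
  obtain ⟨e⟩ : Nonempty (Fin n ≃ t) := ⟨(Fintype.equivFinOfCardEq hcard).symm⟩
  -- points realising the rows
  have hpre : ∀ i : Fin n, ∃ x : X, r x = (e i : Fin n → ℝ) := fun i => by
    obtain ⟨x, hx⟩ := ht (e i).2
    exact ⟨x, hx⟩
  choose p hp using hpre
  refine ⟨p, ?_⟩
  rw [← Matrix.linearIndependent_rows_iff_isUnit]
  have hrows : (Matrix.of fun i j => g j (p i)).row = fun i => ((e i : t) : Fin n → ℝ) := by
    funext i
    rw [← hp i]
    rfl
  rw [hrows]
  exact hti.comp e e.injective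

/-! ## §6 The analytic-profile conjunct of BRIDGE W -/

/-- Solid harmonics of degree `l ≥ 1` that are linearly independent on `ℝ³` stay linearly independent on the unit sphere
(homogeneity). [folklore] -/
theorem linearIndependent_sphere {l n : ℕ} (hl : 1 ≤ l) {B : Fin n → E3 → ℝ} (hB : ∀ m, IsSolidHarmonic l (B m))
    (hli : LinearIndependent ℝ B) :
    LinearIndependent ℝ (fun m => fun y : {y : E3 // ‖y‖ = 1} => B m (y : E3)) := by
  rw [Fintype.linearIndependent_iff] at hli ⊢
  intro a ha
  apply hli a
  funext y
  have key : ∀ z : {y : E3 // ‖y‖ = 1}, ∑ j, a j * B j (z : E3) = 0 := fun z => by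
    have := congrFun ha z
    simpa [Finset.sum_apply] using this
  simp only [Finset.sum_apply, Pi.smul_apply, smul_eq_mul, Pi.zero_apply]
  by_cases hy : y = 0
  · -- `B_j(0) = 0` in degree `l ≥ 1`
    have h0 : ∀ j, B j 0 = 0 := fun j => by
      have := (hB j).apply_smul 0 (0 : E3)
      rw [zero_smul, zero_pow (by omega), zero_mul] at this
      exact this
    simp [hy, h0]
  · have hn : ‖y‖ ≠ 0 := norm_ne_zero_iff.2 hy
    set z : E3 := ‖y‖⁻¹ • y with hz
    have hz1 : ‖z‖ = 1 := by rw [hz, norm_smul, norm_inv, norm_norm, inv_mul_cancel₀ hn]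
    have hyz : y = ‖y‖ • z := by rw [hz, smul_smul, mul_inv_cancel₀ hn, one_smul]
    have hsum : ∑ j, a j * B j y = ‖y‖ ^ l * ∑ j, a j * B j z := by
      rw [Finset.mul_sum]
      refine Finset.sum_congr rfl fun j _ => ?_
      rw [hyz, (hB j).apply_smul, ← hyz]
      ring
    rw [hsum, key ⟨z, hz1⟩, mul_zero]

/-- **W₂ — THE ANALYTIC-PROFILE CONJUNCT OF BRIDGE W `WindowWedgeAnalyticL` holds**: under the hypotheses of
`WindowWedgeAnalyticL` VERBATIM (degree `l ≥ 1`, open time set, a jointly continuous, locally bounded, unthreaded Oseen-mild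
window whose slices are admissible `l`-isotypic data `u t = isoShellL n (cf t) B x₀` over a linearly independent family of solid
harmonics), every radial coefficient profile `cf t m` is real-analytic on `(0, ∞)`.  Proof: the slice `u t` is real-analytic
(`window_analyticOnNhd_slice`, Lemarié-Rieusset Thm. 9.12); its stream function `ψ = Σ_m c_m(|y|) B_m(y) = ⟪u t(x₀+y), y⟫/(l(l+1))`
(`inner_isoShellL_self`) is therefore analytic; and `c_m(r) = r^{−l} Σ_i (M⁻¹)_{mi} ψ(r p_i)` for unit evaluation points `p_i` with
invertible `M_{ij} = B_j(p_i)` (`exists_points_isUnit`, `linearIndependent_sphere`).  After this, BRIDGE W reduces to its WEDGE LAW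
`… → ∀ t ∈ S, WedgeVanishesL n (cf t)` alone; the divergence-free and unthreaded hypotheses are not used here.
HONEST LABEL: half of one M–L bridge of a RUNG line; `UnthreadedRigidity` (27585), W2, NS regularity OPEN. [cite: LemarieRieusset2016, Thm. 9.12 (PDF p. 260)] -/
theorem windowWedge_analytic_profiles :
    ∀ (l n : ℕ) (S : Set ℝ), 1 ≤ l → IsOpen S → ∀ (u : ℝ → E3 → E3) (x₀ : E3),
    ContinuousOn (Function.uncurry u) (S ×ˢ Set.univ) →
    (∀ t ∈ S, Literature.Analysis.FluidPDE.VectorCalculus.IsDivFree (u t)) →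
    (∀ s ∈ S, ∀ t ∈ S, s < t → ∀ x, u t x =
        Literature.Analysis.UnboundedOperators.heatExtension (u s) (t - s) x
          - Literature.Analysis.FluidPDE.oseenDuhamel 1 s u u t x) →
    (∀ τ ∈ S, ∃ B : ℝ, ∀ t ∈ S, t ≤ τ → ∀ x, ‖u t x‖ ≤ B) →
    (∀ t ∈ S, ∀ x, inner ℝ (Literature.Analysis.FluidPDE.curl (u t) x) (x - x₀) = 0) →
    ∀ (B : Fin n → E3 → ℝ) (cf : ℝ → Fin n → ℝ → ℝ), LinearIndependent ℝ B →
    (∀ t ∈ S, IsoAdmissibleL l n (cf t) B ∧ u t = isoShellL n (cf t) B x₀) →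
    ∀ t ∈ S, ∀ m, AnalyticOnNhd ℝ (cf t m) (Set.Ioi 0) := by
  intro l n S hl hS u x₀ hcont _hdiv hmild hbdd _hunth B cf hB hslice t ht m
  obtain ⟨hadm, hu⟩ := hslice t ht
  have hua : AnalyticOnNhd ℝ (u t) univ := window_analyticOnNhd_slice hS hcont hmild hbdd ht
  set L : ℝ := (l : ℝ) * ((l : ℝ) + 1) with hL
  have hL0 : L ≠ 0 := by
    have : (0 : ℝ) < l := by exact_mod_cast hl
    positivity
  -- the stream function `ψ` is analytic
  set ψ : E3 → ℝ := fun y => ∑ j, cf t j ‖y‖ * B j y with hψ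
  have hψ_eq : ∀ y, ψ y = L⁻¹ * inner ℝ (u t (x₀ + y)) y := fun y => by
    rw [hu, inner_isoShellL_self hl hadm x₀ y, ← hL, ← mul_assoc, inv_mul_cancel₀ hL0, one_mul]
  have hψa : ∀ y, AnalyticAt ℝ ψ y := by
    intro y
    have h1 : AnalyticAt ℝ (fun z : E3 => u t (x₀ + z)) y :=
      (hua (x₀ + y) (mem_univ _)).comp (analyticAt_const.add analyticAt_id)
    have h2 : AnalyticAt ℝ (fun z : E3 => inner ℝ (u t (x₀ + z)) z) y := by
      have hb := ((innerSL ℝ (E := E3)).analyticAt_bilinear (u t (x₀ + y), y)).comp₂ h1 analyticAt_id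
      exact hb.congr (Eventually.of_forall fun z => rfl)
    have h3 : AnalyticAt ℝ (fun z : E3 => L⁻¹ * inner ℝ (u t (x₀ + z)) z) y := analyticAt_const.mul h2
    exact h3.congr (Eventually.of_forall fun z => (hψ_eq z).symm)
  -- unit evaluation points with invertible evaluation matrix
  obtain ⟨p, hp⟩ := exists_points_isUnit _ (linearIndependent_sphere hl hadm.1 hB)
  set M : Matrix (Fin n) (Fin n) ℝ := Matrix.of fun i j => B j (p i : E3) with hM
  have hMdet : IsUnit M.det := (Matrix.isUnit_iff_isUnit_det _).1 hp
  -- extraction: `c(r) = M⁻¹ (r^{-l} ψ(r p_i))_i` for `r > 0`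
  have hformula : ∀ r : ℝ, 0 < r → ∀ j,
      cf t j r = M⁻¹.mulVec (fun i => (r ^ l)⁻¹ * ψ (r • (p i : E3))) j := by
    intro r hr j
    have hrl : r ^ l ≠ 0 := pow_ne_zero _ hr.ne'
    have hvec : M.mulVec (fun j => cf t j r) = fun i => (r ^ l)⁻¹ * ψ (r • (p i : E3)) := by
      funext i
      have hnorm : ‖r • (p i : E3)‖ = r := by
        rw [norm_smul, (p i).2, mul_one, Real.norm_of_nonneg hr.le]
      have hψi : ψ (r • (p i : E3)) = r ^ l * ∑ j, M i j * cf t j r := by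
        simp only [hψ, hnorm, hM, Matrix.of_apply, Finset.mul_sum]
        refine Finset.sum_congr rfl fun j _ => ?_
        rw [(hadm.1 j).apply_smul]
        ring
      rw [hψi, ← mul_assoc, inv_mul_cancel₀ hrl, one_mul]
      rfl
    have h2 := congrArg M⁻¹.mulVec hvec
    rw [Matrix.mulVec_mulVec, Matrix.nonsing_inv_mul _ hMdet, Matrix.one_mulVec] at h2
    exact congrFun h2 j
  -- analyticity in `r > 0`
  intro r hr
  have hterm : ∀ i, AnalyticAt ℝ (fun r : ℝ => (r ^ l)⁻¹ * ψ (r • (p i : E3))) r := fun i =>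
    ((analyticAt_id.pow l).inv (pow_ne_zero _ (ne_of_gt hr))).mul
      ((hψa _).comp (analyticAt_id.smul analyticAt_const))
  have hsum : AnalyticAt ℝ (fun r : ℝ => ∑ i, M⁻¹ m i * ((r ^ l)⁻¹ * ψ (r • (p i : E3)))) r :=
    Finset.univ.analyticAt_fun_sum fun i _ => analyticAt_const.mul (hterm i)
  refine hsum.congr ?_
  filter_upwards [Ioi_mem_nhds hr] with r' hr'
  rw [hformula r' hr' m]
  rfl

/-- GLUE (critic's pin): BRIDGE W IS NOW LITERALLY ITS WEDGE LAW — if, under W's hypotheses VERBATIM, every slice has vanishing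
radial Wronskians (`WedgeVanishesL n (cf t)`, the order-one law + injectivity of `{·,·}` on `Λ²V_l`; NOT proved here), then
`WindowWedgeAnalyticL` holds (the analytic-profile conjunct being `windowWedge_analytic_profiles`). -/
theorem windowWedgeAnalyticL_of_wedgeLaw
    (hW : ∀ (l n : ℕ) (S : Set ℝ), 1 ≤ l → IsOpen S → ∀ (u : ℝ → E3 → E3) (x₀ : E3),
      ContinuousOn (Function.uncurry u) (S ×ˢ Set.univ) →
      (∀ t ∈ S, Literature.Analysis.FluidPDE.VectorCalculus.IsDivFree (u t)) →
      (∀ s ∈ S, ∀ t ∈ S, s < t → ∀ x, u t x =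
          Literature.Analysis.UnboundedOperators.heatExtension (u s) (t - s) x
            - Literature.Analysis.FluidPDE.oseenDuhamel 1 s u u t x) →
      (∀ τ ∈ S, ∃ B : ℝ, ∀ t ∈ S, t ≤ τ → ∀ x, ‖u t x‖ ≤ B) →
      (∀ t ∈ S, ∀ x, inner ℝ (Literature.Analysis.FluidPDE.curl (u t) x) (x - x₀) = 0) →
      ∀ (B : Fin n → E3 → ℝ) (cf : ℝ → Fin n → ℝ → ℝ), LinearIndependent ℝ B →
      (∀ t ∈ S, IsoAdmissibleL l n (cf t) B ∧ u t = isoShellL n (cf t) B x₀) →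
      ∀ t ∈ S, WedgeVanishesL n (cf t)) :
    WindowWedgeAnalyticL := by
  intro l n S hl hS u x₀ hcont hdiv hmild hbdd hunth B cf hB hslice t ht
  exact ⟨hW l n S hl hS u x₀ hcont hdiv hmild hbdd hunth B cf hB hslice t ht,
    windowWedge_analytic_profiles l n S hl hS u x₀ hcont hdiv hmild hbdd hunth B cf hB hslice t ht⟩

end Summit.NavierStokesRegularity.NavierStokesRegularity.Theorems.UnthreadedRigidity.VirialHorn
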